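import Summits.ResolutionOfSingularities.ResolutionOfSingularities.Theses.DefectlessFrames

/-!
# Crux `DefectlessFramesR` (stmt-ResolutionOfSingularities-17921) — the strengthening "keep the transcendence basis" is false

Route `ResolutionOfSingularities/DefectlessFrames`, crux `DefectlessFramesR` (defectless separable
re-framing `(y'; z'; f')` of a hypersurface frame `(y; z; f)` along a rank-one zero-dimensional
valuation over a perfect field).  `defectlessFramesR_false_with_fixed_y` proves that the natural
STRENGTHENING of the crux in which only the primitive element and the relation are re-chosen
(conjunct `y' = y` added to the conclusion, everything else verbatim) is FALSE — already over the
perfect field `𝔽₂` and already for `n = 1`.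

Witness: `p = 2`, `k = 𝔽₂`, `K = 𝔽₂(τ)`, `O` = the `τ`-adic valuation ring (rank one, residue
field `𝔽₂`), GENUINE frame `n = 1`, `y₀ = τ²`, `z = τ`, `f = X₁² - X₀ ≠ 0` (axis polynomial
`f(ȳ, X) = X²`, axis order `s = 2 = p`): `τ²` is transcendental, `k(τ², τ) = K`, and
`span {f} = ker (aeval (τ², τ))` (division with remainder by the monic `X₁² - X₀`, then
`r₀(τ²) + r₁(τ²)·τ = 0 ⇒ r₀ = r₁ = 0` by differentiating in characteristic `2`).  With `y' = y`
the conclusion asks for `z'` SEPARABLE over `k(τ²)` with `k(τ², z') = K ∋ τ`; then `τ` is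
separable over `k(τ²)` and `τ² ∈ k(τ²)`, so `τ ∈ k(τ²)` (separable ∩ perfect closure = base),
`τ·s(τ²) = r(τ²)` in `k[τ]`, and `d/dτ` gives `s(τ²) = 0`, `s = 0` — absurd.
Moral for provers: the transcendence basis must MOVE (Zariski A.IV / Nagata twist
`y' = y + z^N`); re-choosing the primitive element alone cannot produce separability, let alone
defectlessness.  By-product: the hypotheses of the crux are met by a genuine frame with `n = 1`,
`s = 2` (kernel-checked non-vacuity beyond the `n = 0` / `s = 1` corners).
No definitions, no facts; kernel-only (cdisprove seat, 2026-08-17).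
-/

set_option linter.dupNamespace false

open scoped Polynomial
open IsDedekindDomain.HeightOneSpectrum

namespace Summit.ResolutionOfSingularities.ResolutionOfSingularities.Theorems

noncomputable section

section Witness

variable (F : Type) [Field F]


/-- `X ∈ F[X]_{(X)}`. [folklore] -/
theorem dfrNegD_X_mem_OX : (RatFunc.X : RatFunc F) ∈ ((Polynomial.idealX F).valuation (RatFunc F)).valuationSubring := by
  rw [Valuation.mem_valuationSubring_iff]
  change ((Polynomial.idealX F).valuation (RatFunc F)) RatFunc.X ≤ 1
  rw [Polynomial.valuation_X_eq_neg_one, ← WithZero.exp_zero, WithZero.exp_le_exp]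
  decide

/-- Polynomials lie in `F[X]_{(X)}`. [folklore] -/
theorem dfrNegD_polynomial_mem_OX (q : F[X]) : algebraMap F[X] (RatFunc F) q ∈ ((Polynomial.idealX F).valuation (RatFunc F)).valuationSubring := by
  rw [Valuation.mem_valuationSubring_iff]
  exact valuation_le_one _ _

/-- Constants lie in `F[X]_{(X)}`. [folklore] -/
theorem dfrNegD_const_mem_OX (c : F) : algebraMap F (RatFunc F) c ∈ ((Polynomial.idealX F).valuation (RatFunc F)).valuationSubring := by
  rw [IsScalarTower.algebraMap_apply F F[X] (RatFunc F)]
  exact dfrNegD_polynomial_mem_OX F _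

/-- The valuation of `OX` is equivalent to the `X`-adic valuation. [folklore] -/
theorem dfrNegD_isEquiv_OX : ((Polynomial.idealX F).valuation (RatFunc F)).IsEquiv ((Polynomial.idealX F).valuation (RatFunc F)).valuationSubring.valuation := Valuation.isEquiv_valuation_valuationSubring _

/-- `F[X]_{(X)}` has rank one. [folklore] -/
theorem dfrNegD_rankOne_OX : Nonempty ((Polynomial.idealX F).valuation (RatFunc F)).valuationSubring.valuation.RankOne := by
  haveI : ((Polynomial.idealX F).valuation (RatFunc F)).valuationSubring.valuation.IsNontrivial := by
    refine ⟨RatFunc.X, ?_, ?_⟩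
    · simp [RatFunc.X_ne_zero]
    · intro h1
      have := ((dfrNegD_isEquiv_OX F).symm.eq_one_iff_eq_one).mp h1
      simp [Polynomial.valuation_X_eq_neg_one] at this
  rw [Valuation.nonempty_rankOne_iff_mulArchimedean]
  haveI h1 : MulArchimedean (MonoidWithZeroHom.ValueGroup₀ (.ofClass ((Polynomial.idealX F).valuation (RatFunc F)))) :=
    MulArchimedean.comap MonoidWithZeroHom.ValueGroup₀.embedding.toMonoidHom
      MonoidWithZeroHom.ValueGroup₀.embedding_strictMono
  exact MulArchimedean.comap ((dfrNegD_isEquiv_OX F).symm.orderMonoidIso).toMonoidHom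
    ((dfrNegD_isEquiv_OX F).symm.orderMonoidIso).strictMono

/-- Every element of `F[X]_{(X)}` is congruent to a constant of `F` modulo the maximal ideal
(the residue field is `F`). [folklore] -/
theorem dfrNegD_exists_const_sub_lt_one (x : RatFunc F) (hx : x ∈ ((Polynomial.idealX F).valuation (RatFunc F)).valuationSubring) :
    ∃ c : F, ((Polynomial.idealX F).valuation (RatFunc F)) (x - algebraMap F (RatFunc F) c) < 1 := by
  rw [Valuation.mem_valuationSubring_iff] at hx
  have hd : x.denom ≠ 0 := RatFunc.denom_ne_zero x
  have hd' : algebraMap F[X] (RatFunc F) x.denom ≠ 0 := RatFunc.algebraMap_ne_zero hd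
  -- the denominator is not divisible by `X`
  have hd0 : x.denom.coeff 0 ≠ 0 := by
    intro h0
    have hXd : Polynomial.X ∣ x.denom := Polynomial.X_dvd_iff.mpr h0
    have hvd : (Polynomial.idealX F).intValuation x.denom < 1 :=
      (intValuation_lt_one_iff_mem _ _).mpr
        (by rw [Polynomial.idealX_span]; exact Ideal.mem_span_singleton.mpr hXd)
    have hXn : ¬ Polynomial.X ∣ x.num := by
      intro hXn
      obtain ⟨a, b, hab⟩ := RatFunc.isCoprime_num_denom x
      have : Polynomial.X ∣ (1 : F[X]) := hab ▸ dvd_add (dvd_mul_of_dvd_right hXn a)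
        (dvd_mul_of_dvd_right hXd b)
      exact Polynomial.not_isUnit_X (isUnit_of_dvd_one this)
    have hvn : (Polynomial.idealX F).intValuation x.num = 1 :=
      intValuation_eq_one_iff.mpr
        (by rw [Polynomial.idealX_span]; exact fun h => hXn (Ideal.mem_span_singleton.mp h))
    have hvx : ((Polynomial.idealX F).valuation (RatFunc F)) x = 1 / (Polynomial.idealX F).intValuation x.denom := by
      conv_lhs => rw [← RatFunc.num_div_denom x]
      rw [map_div₀, valuation_of_algebraMap, valuation_of_algebraMap, hvn]
    have hpos : 0 < (Polynomial.idealX F).intValuation x.denom :=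
      zero_lt_iff.mpr (intValuation_ne_zero _ _ hd)
    have : 1 < ((Polynomial.idealX F).valuation (RatFunc F)) x := by
      rw [hvx, one_div, one_lt_inv₀ hpos]; exact hvd
    exact absurd hx (not_le.mpr this)
  have hvd : (Polynomial.idealX F).intValuation x.denom = 1 :=
    intValuation_eq_one_iff.mpr (by
      rw [Polynomial.idealX_span]
      exact fun h => hd0 (Polynomial.X_dvd_iff.mp (Ideal.mem_span_singleton.mp h)))
  set c : F := x.num.coeff 0 / x.denom.coeff 0 with hc
  refine ⟨c, ?_⟩
  have hx' : x - algebraMap F (RatFunc F) c =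
      algebraMap F[X] (RatFunc F) (x.num - Polynomial.C c * x.denom) / algebraMap F[X] (RatFunc F) x.denom := by
    rw [map_sub, map_mul, sub_div, mul_div_assoc, div_self hd', mul_one,
      IsScalarTower.algebraMap_apply F F[X] (RatFunc F) c, Polynomial.algebraMap_eq, RatFunc.num_div_denom]
  rw [hx', map_div₀, valuation_of_algebraMap, valuation_of_algebraMap, hvd, div_one,
    intValuation_lt_one_iff_mem, Polynomial.idealX_span, Ideal.mem_span_singleton,
    Polynomial.X_dvd_iff]
  simp [hc, div_mul_cancel₀ _ hd0]

/-- `F[X]_{(X)}` is zero-dimensional over `F`: every residue is a root of a nonzero polynomial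
over `F` (namely `X - c`). [folklore] -/
theorem dfrNegD_zeroDim_OX (x : RatFunc F) (hx : x ∈ ((Polynomial.idealX F).valuation (RatFunc F)).valuationSubring) :
    ∃ g : Polynomial F, g ≠ 0 ∧ Polynomial.aeval x g ∈ ((Polynomial.idealX F).valuation (RatFunc F)).valuationSubring.nonunits := by
  obtain ⟨c, hc⟩ := dfrNegD_exists_const_sub_lt_one F x hx
  refine ⟨Polynomial.X - Polynomial.C c, Polynomial.X_sub_C_ne_zero c, ?_⟩
  rw [ValuationSubring.mem_nonunits_iff, ← (dfrNegD_isEquiv_OX F).lt_one_iff_lt_one]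
  simpa only [map_sub, Polynomial.aeval_X, Polynomial.aeval_C] using hc

/-- `F(X)` is finitely generated over `F`. [folklore] -/
theorem dfrNegD_fg_top : (⊤ : IntermediateField F (RatFunc F)).FG := ⟨{RatFunc.X}, by simp [RatFunc.adjoin_X]⟩

end Witness

/-- Division with remainder by `X₁² - b(X₀)` in `k[X₀, X₁]`. [folklore] -/
theorem dfrNegD_div_sq_sub_aeval {k : Type} [Field k] (b : Polynomial k) (g : MvPolynomial (Fin (1 + 1)) k) :
    ∃ (q : MvPolynomial (Fin (1 + 1)) k) (r₀ r₁ : Polynomial k),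
      g = q * (MvPolynomial.X 1 ^ 2 - Polynomial.aeval (MvPolynomial.X 0) b) +
        Polynomial.aeval (MvPolynomial.X 0) r₀ + Polynomial.aeval (MvPolynomial.X 0) r₁ * MvPolynomial.X 1 := by
  induction g using MvPolynomial.induction_on with
  | C c =>
    refine ⟨0, Polynomial.C c, 0, ?_⟩
    simp [MvPolynomial.algebraMap_eq]
  | add p q hp hq =>
    obtain ⟨q₁, r₀, r₁, rfl⟩ := hp
    obtain ⟨q₂, s₀, s₁, rfl⟩ := hq
    refine ⟨q₁ + q₂, r₀ + s₀, r₁ + s₁, ?_⟩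
    simp only [map_add]
    ring
  | mul_X p i hp =>
    obtain ⟨q, r₀, r₁, rfl⟩ := hp
    fin_cases i
    · refine ⟨q * MvPolynomial.X 0, r₀ * Polynomial.X, r₁ * Polynomial.X, ?_⟩
      simp only [Fin.zero_eta, map_mul, Polynomial.aeval_X]
      ring
    · refine ⟨q * MvPolynomial.X 1 + Polynomial.aeval (MvPolynomial.X 0) r₁, b * r₁, r₀, ?_⟩
      simp only [Fin.mk_one, map_mul]
      ring

/-- In characteristic `2`, `r₀(T²) + r₁(T²)·T = 0` forces `r₀ = r₁ = 0` (differentiate: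
`d/dT` kills `r₀(T²)` and `r₁(T²)`, leaving `r₁(T²) = 0`). [folklore] -/
theorem dfrNegD_expand_two_add_expand_two_mul_X {k : Type} [Field k] [CharP k 2] (r₀ r₁ : Polynomial k)
    (h : Polynomial.expand k 2 r₀ + Polynomial.expand k 2 r₁ * Polynomial.X = 0) : r₀ = 0 ∧ r₁ = 0 := by
  have h2 : ((2 : ℕ) : Polynomial k) = 0 := CharP.cast_eq_zero _ 2
  have hd := congrArg Polynomial.derivative h
  rw [Polynomial.derivative_add, Polynomial.derivative_mul, Polynomial.derivative_expand,
    Polynomial.derivative_expand, h2, zero_mul, mul_zero, mul_zero, zero_mul, zero_add, zero_add,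
    Polynomial.derivative_X, mul_one, Polynomial.derivative_zero, Polynomial.expand_eq_zero two_pos] at hd
  refine ⟨?_, hd⟩
  rwa [hd, map_zero, zero_mul, add_zero, Polynomial.expand_eq_zero two_pos] at h

/-- **Re-choosing only `z` does not suffice**: the statement below is the crux
`DefectlessFrames.DefectlessFramesR` with the single conjunct `y' = y` ADDED to its conclusion
(nothing else changed), and it is false over the PERFECT field `𝔽₂`: the genuine frame `K = 𝔽₂(τ)`, `O` the `τ`-adic ring, `n = 1`, `y₀ = τ²`, `z = τ`,
`f = X₁² - X₀` (axis order `s = 2 = p`) meets every hypothesis of the crux, but `K/k(y₀)` is purely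
inseparable, so NO `z'` generating `K` over `k(y₀)` is separable: `τ` separable over `k(τ²)` with
`τ² ∈ k(τ²)` gives `τ ∈ k(τ²)`, `τ·s(τ²) = r(τ²)` in `k[τ]`, and differentiating gives `s = 0`.
So any proof of `DefectlessFramesR` must move the transcendence basis (Zariski A.IV / Nagata
twist `y' = y + z^N`), not only the primitive element.  By-product: the hypotheses of the crux are
met by a genuine frame with `n = 1`, `s = 2` (non-vacuity certificate). [folklore] -/
theorem defectlessFramesR_false_with_fixed_y : ¬ (∀ p : ℕ, p.Prime → ∀ (k K : Type) [Field k] [CharP k p] [PerfectField k] [Field K] [Algebra k K], (⊤ : IntermediateField k K).FG → ∀ O : ValuationSubring K, ∀ hk : (∀ c : k, algebraMap k K c ∈ O), Nonempty O.valuation.RankOne → (∀ x ∈ O, ∃ f : Polynomial k, f ≠ 0 ∧ Polynomial.aeval x f ∈ O.nonunits) → let ρ : k →+* IsLocalRing.ResidueField O := (IsLocalRing.residue O).comp ((algebraMap k K).codRestrict O hk); let axis : (m : ℕ) → (Fin m → O) → MvPolynomial (Fin (m + 1)) k → Polynomial (IsLocalRing.ResidueField O) := fun _ w g => MvPolynomial.eval₂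 (Polynomial.C.comp ρ) (Fin.snoc (fun j => Polynomial.C (IsLocalRing.residue O (w j))) Polynomial.X) g; ∀ (n : ℕ) (y : Fin n → O) (z : O) (f : MvPolynomial (Fin (n + 1)) k), AlgebraicIndependent k (fun i => (y i : K)) → IntermediateField.adjoin k (Set.range (fun i => (y i : K)) ∪ {(z : K)}) = ⊤ → Ideal.span {f} = RingHom.ker (MvPolynomial.aeval (Fin.snoc (fun i => (y i : K)) (z : K)) : MvPolynomial (Fin (n + 1)) k →ₐ[k] K) → f ≠ 0 → ∃ (y' : Fin n → O) (z' : O) (f' : MvPolynomial (Fin (n + 1)) k), y' = y ∧ AlgebraicIndependent k (fun i => (y' i : K)) ∧ IsIntegral (Algebra.adjoin k (Set.range fun i => (y' i : K))) (z' : K) ∧ IntermediateField.adjoin k (Set.range (fun i => (y' i : K)) ∪ {(z' : K)}) = ⊤ ∧ Ideal.span {f'} = RingHom.ker (MvPolynomial.aeval (Fin.snoc (fun i => (y' i : K)) (z' : K)) : MvPolynomial (Fin (n + 1)) k →ₐ[k] K) ∧ (∀ i, (y i : K) ∈ Algebra.adjoin k (Set.range (fun i => (y' i : K)) ∪ {(z'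 : K)})) ∧ (z : K) ∈ Algebra.adjoin k (Set.range (fun i => (y' i : K)) ∪ {(z' : K)}) ∧ axis n y' f' ≠ 0 ∧ (axis n y f ≠ 0 → (axis n y' f').rootMultiplicity (IsLocalRing.residue O z') ≤ (axis n y f).rootMultiplicity (IsLocalRing.residue O z)) ∧ IsSeparable (IntermediateField.adjoin k (Set.range fun i => (y' i : K))) (z' : K) ∧ ∀ (Ω : Type) [Field Ω] [Algebra K Ω] [IsAlgClosure K Ω] (V : ValuationSubring Ω), V.comap (algebraMap K Ω) = O → let F : Subfield Ω := (IntermediateField.adjoin k (Set.range fun i => (y' i : K))).toSubfield.map (algebraMap K Ω); let Fh : Subfield Ω := (IntermediateField.lift (IntermediateField.fixedField (ValuationSubring.decompositionSubgroup F (V.comap (algebraMap (separableClosure F Ω) Ω))))).toSubfield; let T : Subfield Ω := Fh ⊔ (algebraMap K Ω).fieldRange; Fh ≤ T ∧ 0 < Subfield.relfinrank Fh T ∧ Subfield.relfinrank Fh T = (Literature.AlgebraicGeometry.Resolution.valueSubgroup Fh V).relIndex (Literature.AlgebraicGeometry.Resolution.valueSubgroup T V) * (Literature.AlgebraicGeometry.Resolution.residueSubfield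 Fh V).relfinrank (Literature.AlgebraicGeometry.Resolution.residueSubfield T V)) := by
  intro h
  classical
  have h1 := h 2 Nat.prime_two (ZMod 2) (RatFunc (ZMod 2)) (dfrNegD_fg_top _) ((Polynomial.idealX (ZMod 2)).valuation (RatFunc (ZMod 2))).valuationSubring (dfrNegD_const_mem_OX _)
    (dfrNegD_rankOne_OX _) (dfrNegD_zeroDim_OX _)
  -- the frame `y₀ = τ²`, `z = τ`, `f = X₁² - X₀`
  have hτ2 : (RatFunc.X : RatFunc (ZMod 2)) ^ 2 ∈ ((Polynomial.idealX (ZMod 2)).valuation (RatFunc (ZMod 2))).valuationSubring := pow_mem (dfrNegD_X_mem_OX _) 2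
  let y : Fin 1 → ((Polynomial.idealX (ZMod 2)).valuation (RatFunc (ZMod 2))).valuationSubring := fun _ => ⟨RatFunc.X ^ 2, hτ2⟩
  let z : ((Polynomial.idealX (ZMod 2)).valuation (RatFunc (ZMod 2))).valuationSubring := ⟨RatFunc.X, dfrNegD_X_mem_OX _⟩
  have hy : AlgebraicIndependent (ZMod 2) (fun i => ((y i : ((Polynomial.idealX (ZMod 2)).valuation (RatFunc (ZMod 2))).valuationSubring) : RatFunc (ZMod 2))) := by
    rw [algebraicIndependent_singleton_iff (0 : Fin 1)]
    exact RatFunc.transcendental_X.pow two_pos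
  have hadj : IntermediateField.adjoin (ZMod 2) (Set.range (fun i => ((y i : ((Polynomial.idealX (ZMod 2)).valuation (RatFunc (ZMod 2))).valuationSubring) : RatFunc (ZMod 2))) ∪
      {((z : ((Polynomial.idealX (ZMod 2)).valuation (RatFunc (ZMod 2))).valuationSubring) : RatFunc (ZMod 2))}) = ⊤ := by
    rw [eq_top_iff, ← RatFunc.adjoin_X]
    exact IntermediateField.adjoin.mono _ _ _ Set.subset_union_right
  have hv0 : (Fin.snoc (fun i => ((y i : ((Polynomial.idealX (ZMod 2)).valuation (RatFunc (ZMod 2))).valuationSubring) : RatFunc (ZMod 2))) ((z : ((Polynomial.idealX (ZMod 2)).valuation (RatFunc (ZMod 2))).valuationSubring) : RatFunc (ZMod 2)) :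
      Fin (1 + 1) → RatFunc (ZMod 2)) 0 = RatFunc.X ^ 2 := rfl
  have hv1 : (Fin.snoc (fun i => ((y i : ((Polynomial.idealX (ZMod 2)).valuation (RatFunc (ZMod 2))).valuationSubring) : RatFunc (ZMod 2))) ((z : ((Polynomial.idealX (ZMod 2)).valuation (RatFunc (ZMod 2))).valuationSubring) : RatFunc (ZMod 2)) :
      Fin (1 + 1) → RatFunc (ZMod 2)) 1 = RatFunc.X := rfl
  have hf0 : MvPolynomial.aeval (Fin.snoc (fun i => ((y i : ((Polynomial.idealX (ZMod 2)).valuation (RatFunc (ZMod 2))).valuationSubring) : RatFunc (ZMod 2)))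
      ((z : ((Polynomial.idealX (ZMod 2)).valuation (RatFunc (ZMod 2))).valuationSubring) : RatFunc (ZMod 2)) : Fin (1 + 1) → RatFunc (ZMod 2))
      (MvPolynomial.X 1 ^ 2 - MvPolynomial.X 0 : MvPolynomial (Fin (1 + 1)) (ZMod 2)) = 0 := by
    rw [map_sub, map_pow, MvPolynomial.aeval_X, MvPolynomial.aeval_X, hv0, hv1, sub_self]
  have hker : Ideal.span {(MvPolynomial.X 1 ^ 2 - MvPolynomial.X 0 : MvPolynomial (Fin (1 + 1)) (ZMod 2))} =
      RingHom.ker (MvPolynomial.aeval (Fin.snoc (fun i => ((y i : ((Polynomial.idealX (ZMod 2)).valuation (RatFunc (ZMod 2))).valuationSubring) : RatFunc (ZMod 2)))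
        ((z : ((Polynomial.idealX (ZMod 2)).valuation (RatFunc (ZMod 2))).valuationSubring) : RatFunc (ZMod 2))) : MvPolynomial (Fin (1 + 1)) (ZMod 2) →ₐ[ZMod 2] RatFunc (ZMod 2)) := by
    apply le_antisymm
    · rw [Ideal.span_le, Set.singleton_subset_iff, SetLike.mem_coe, RingHom.mem_ker]
      exact hf0
    · intro g hg
      rw [RingHom.mem_ker] at hg
      obtain ⟨q, r₀, r₁, rfl⟩ := dfrNegD_div_sq_sub_aeval Polynomial.X g
      rw [Polynomial.aeval_X] at hg ⊢
      rw [map_add, map_add, map_mul, map_mul, hf0, mul_zero, zero_add, ← Polynomial.aeval_algHom_apply,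
        ← Polynomial.aeval_algHom_apply, MvPolynomial.aeval_X, MvPolynomial.aeval_X, hv0, hv1,
        ← Polynomial.expand_aeval, ← Polynomial.expand_aeval,
        RatFunc.aeval_X_left_eq_algebraMap, RatFunc.aeval_X_left_eq_algebraMap, ← RatFunc.algebraMap_X,
        ← map_mul, ← map_add, map_eq_zero_iff _ (RatFunc.algebraMap_injective (ZMod 2))] at hg
      obtain ⟨hr₀, hr₁⟩ := dfrNegD_expand_two_add_expand_two_mul_X r₀ r₁ hg
      simp only [hr₀, hr₁, map_zero, zero_mul, add_zero]
      exact Ideal.mul_mem_left _ q (Ideal.subset_span rfl)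
  have hf : (MvPolynomial.X 1 ^ 2 - MvPolynomial.X 0 : MvPolynomial (Fin (1 + 1)) (ZMod 2)) ≠ 0 := by
    intro h0
    have := congrArg (MvPolynomial.eval (Fin.snoc (fun _ : Fin 1 => (1 : ZMod 2)) 0 : Fin (1 + 1) → ZMod 2)) h0
    rw [map_sub, map_pow, MvPolynomial.eval_X, MvPolynomial.eval_X, map_zero] at this
    exact absurd this (by decide)
  obtain ⟨y', z', f', hyy, -, -, hadj', -, -, -, -, -, hsep, -⟩ := h1 1 y z _ hy hadj hker hf
  subst hyy
  -- `F₁ = k(τ²)`, `K = F₁(z')` with `z'` separable, so `τ` is separable over `F₁`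
  generalize hF₁ : IntermediateField.adjoin (ZMod 2)
    (Set.range fun i => ((y i : ((Polynomial.idealX (ZMod 2)).valuation (RatFunc (ZMod 2))).valuationSubring) : RatFunc (ZMod 2))) = F₁ at hsep
  have hzt : IntermediateField.adjoin F₁ {((z' : ((Polynomial.idealX (ZMod 2)).valuation (RatFunc (ZMod 2))).valuationSubring) : RatFunc (ZMod 2))} = ⊤ := by
    rw [← IntermediateField.restrictScalars_eq_top_iff (K := ZMod 2),
      IntermediateField.restrictScalars_adjoin, eq_top_iff, ← hadj', ← hF₁]
    exact IntermediateField.adjoin.mono _ _ _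
      (Set.union_subset_union_left _ (IntermediateField.subset_adjoin _ _))
  haveI hKsep : Algebra.IsSeparable F₁ (IntermediateField.adjoin F₁ {((z' : ((Polynomial.idealX (ZMod 2)).valuation (RatFunc (ZMod 2))).valuationSubring) : RatFunc (ZMod 2))}) :=
    (IntermediateField.isSeparable_adjoin_simple_iff_isSeparable (F := F₁) (E := RatFunc (ZMod 2))).mpr hsep
  have hsepτ : IsSeparable F₁ (RatFunc.X : RatFunc (ZMod 2)) := by
    have hτ_top : (RatFunc.X : RatFunc (ZMod 2)) ∈
        IntermediateField.adjoin F₁ {((z' : ((Polynomial.idealX (ZMod 2)).valuation (RatFunc (ZMod 2))).valuationSubring) : RatFunc (ZMod 2))} := by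
      rw [hzt]; exact IntermediateField.mem_top
    exact IntermediateField.isSeparable_of_mem_isSeparable (F := F₁) (E := RatFunc (ZMod 2)) hτ_top
  -- `τ² ∈ F₁`: separable and purely inseparable, hence `τ ∈ F₁`
  have hτF : (RatFunc.X : RatFunc (ZMod 2)) ∈ F₁ := by
    have h1' : (RatFunc.X : RatFunc (ZMod 2)) ∈ separableClosure F₁ (RatFunc (ZMod 2)) :=
      mem_separableClosure_iff.mpr hsepτ
    have h2' : (RatFunc.X : RatFunc (ZMod 2)) ∈ perfectClosure F₁ (RatFunc (ZMod 2)) := by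
      rw [mem_perfectClosure_iff_pow_mem 2]
      have hmem : (RatFunc.X : RatFunc (ZMod 2)) ^ 2 ∈ F₁ := by
        rw [← hF₁]
        exact IntermediateField.subset_adjoin _ _ ⟨0, rfl⟩
      exact ⟨1, ⟨⟨_, hmem⟩, by rw [pow_one]; rfl⟩⟩
    have h3 : (RatFunc.X : RatFunc (ZMod 2)) ∈
        separableClosure F₁ (RatFunc (ZMod 2)) ⊓ perfectClosure F₁ (RatFunc (ZMod 2)) :=
      IntermediateField.mem_inf.mpr ⟨h1', h2'⟩
    rw [separableClosure_inf_perfectClosure, IntermediateField.mem_bot] at h3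
    obtain ⟨w, hw⟩ := h3
    rw [← hw]
    exact w.2
  -- `τ ∈ k(τ²)`: write `τ = r(τ²)/s(τ²)` and differentiate `τ·s(τ²) = r(τ²)`
  have hrange' : Set.range (fun i => ((y i : ((Polynomial.idealX (ZMod 2)).valuation (RatFunc (ZMod 2))).valuationSubring) : RatFunc (ZMod 2))) =
      {(RatFunc.X : RatFunc (ZMod 2)) ^ 2} := by
    rw [Set.range_unique]
  rw [← hF₁, hrange', IntermediateField.mem_adjoin_simple_iff] at hτF
  obtain ⟨r, s, hrs⟩ := hτF
  by_cases hs : Polynomial.aeval ((RatFunc.X : RatFunc (ZMod 2)) ^ 2) s = 0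
  · rw [hs, div_zero] at hrs
    exact RatFunc.X_ne_zero hrs
  · rw [eq_div_iff hs, ← Polynomial.expand_aeval, ← Polynomial.expand_aeval,
      RatFunc.aeval_X_left_eq_algebraMap, RatFunc.aeval_X_left_eq_algebraMap, ← RatFunc.algebraMap_X,
      ← map_mul, (RatFunc.algebraMap_injective (ZMod 2)).eq_iff] at hrs
    -- hrs : X * expand 2 s = expand 2 r in k[T]
    have hE : Polynomial.expand (ZMod 2) 2 (-r) + Polynomial.expand (ZMod 2) 2 s * Polynomial.X = 0 := by
      rw [map_neg, ← hrs]; ring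
    obtain ⟨-, hs0⟩ := dfrNegD_expand_two_add_expand_two_mul_X (-r) s hE
    exact hs (by rw [hs0, map_zero])

end

end Summit.ResolutionOfSingularities.ResolutionOfSingularities.Theorems
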